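import Summits.CriticalPhenomena.PercolationContinuityZ3.Theorems.PercNearOneGluingNoHeavyLowerTailKnQuestion8CoefficientwiseGluing
import HarnessLib

/-!
# Parallel gluing of two-terminal pieces in the THROUGH case (F3 of the series–parallel type calculus) — prim-lf-2 gen 69

Support file (`--supports stmt-CriticalPhenomena-4575`, closed), prover `prim-lf-2` (gen 69).  No definitions, no named facts, no sorries; standard axioms.
Memo `prim-lf-2/CW-SP-gen69.md` §3 (F3) and §8(1) (Lean plan for THEOREM SP / U3-CLOSURE).

Setting: two edge sets `s₁`, `s₂` (the red edges of two PIECES glued in parallel at the terminals `x`, `z`) whose edges can only share the vertices `x` and `z`;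
`C_a(s) = openCluster (ends '' s) a`.  Gen 26's `mem_openCluster_union_parallel` computes `C_x(s₁ ∪ s₂) = C_x(s₁) ∪ C_x(s₂)` when `z` is in NEITHER `C_x(sᵢ)`.  The type
calculus of gen 69 needs the general formula (memo §3, PARALLEL): `C_x(s₁ ∪ s₂) = C_x(s₁) ∪ C_x(s₂) ∪ [z ∈ C_x(s₁) ∪ C_x(s₂)]·(C_z(s₁) ∪ C_z(s₂))` — when one piece is
'red-through', the red clusters of `z` in both pieces join the cluster of `x`.
* `Coefficientwise.mem_openCluster_union_parallel_subset` — the inclusion `⊆` with no hypothesis on `z`;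
* `Coefficientwise.mem_openCluster_union_parallel_through` — the equality (as an `iff`) when `z ∈ C_x(s₁) ∪ C_x(s₂)`;
* `Coefficientwise.mem_openCluster_union_parallel_iff` — the general `iff` combining both cases.
[cite: KozmaNitzan2024, Questions 8–9 (§5.5 p. 36) (context: the Question-8 pocket covariance programme)]
-/

namespace Summit.CriticalPhenomena.PercolationContinuityZ3.Theorems

open Finset Literature.Probability.Percolation

namespace Coefficientwise

variable {ι V : Type*}

/-- **Parallel gluing, general inclusion.**  If the edges of `s₁` and of `s₂` can only share the vertices `x, z`, then every vertex of `C_x(s₁ ∪ s₂)` lies in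
`C_x(s₁) ∪ C_x(s₂)` or — only possible when `z ∈ C_x(s₁) ∪ C_x(s₂)` — in `C_z(s₁) ∪ C_z(s₂)`. [cite: KozmaNitzan2024, §5.5 (context only; folklore)] -/
theorem mem_openCluster_union_parallel_subset [DecidableEq ι] (ends : ι → Sym2 V) {s₁ s₂ : Finset ι} {x z : V}
    (hsep : ∀ e ∈ s₁, ∀ e' ∈ s₂, ∀ w : V, w ∈ ends e → w ∈ ends e' → w = x ∨ w = z) {y : V}
    (hy : y ∈ openCluster (ends '' (↑(s₁ ∪ s₂) : Set ι)) x) :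
    y ∈ openCluster (ends '' (↑s₁ : Set ι)) x ∨ y ∈ openCluster (ends '' (↑s₂ : Set ι)) x ∨
      ((z ∈ openCluster (ends '' (↑s₁ : Set ι)) x ∨ z ∈ openCluster (ends '' (↑s₂ : Set ι)) x) ∧
        (y ∈ openCluster (ends '' (↑s₁ : Set ι)) z ∨ y ∈ openCluster (ends '' (↑s₂ : Set ι)) z)) := by
  change (openGraph (ends '' (↑(s₁ ∪ s₂) : Set ι))).Reachable x y at hy
  rw [SimpleGraph.reachable_iff_reflTransGen] at hy
  induction hy with
  | refl => exact Or.inl (mem_openCluster_self _ x)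
  | @tail b c _ hbc ih =>
    have hbc' := hbc
    rw [openGraph_image_adj] at hbc'
    obtain ⟨⟨i, hi12, hi⟩, hne⟩ := hbc'
    have hbi : b ∈ ends i := by rw [hi]; exact Sym2.mem_mk_left b c
    -- generic step: from `b` in some cluster `C_a(s_j)` along an edge `i ∈ s_k`
    -- case split on which piece the edge belongs to
    rcases Finset.mem_union.mp hi12 with hi1 | hi2
    · have hadj1 : (openGraph (ends '' (↑s₁ : Set ι))).Adj b c := by
        rw [openGraph_image_adj]; exact ⟨⟨i, hi1, hi⟩, hne⟩
      -- if `b` lies on an edge of `s₂` and `b ≠ x`, `b ≠ z`-analysis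
      have key : ∀ a : V, b ∈ openCluster (ends '' (↑s₂ : Set ι)) a → b = a ∨ b = x ∨ b = z := by
        intro a hb
        by_cases hba : b = a
        · exact Or.inl hba
        · obtain ⟨e', he', hbe'⟩ := exists_edge_of_mem_openCluster ends hb hba
          exact Or.inr (hsep i hi1 e' he' b hbi hbe')
      rcases ih with hb | hb | ⟨hz, hb | hb⟩
      · exact Or.inl (SimpleGraph.Reachable.trans hb hadj1.reachable)
      · rcases key x hb with rfl | rfl | rfl
        · exact Or.inl hadj1.reachable
        · exact Or.inl hadj1.reachable
        · exact Or.inr (Or.inr ⟨Or.inr hb, Or.inl hadj1.reachable⟩)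
      · exact Or.inr (Or.inr ⟨hz, Or.inl (SimpleGraph.Reachable.trans hb hadj1.reachable)⟩)
      · rcases key z hb with rfl | rfl | rfl
        · exact Or.inr (Or.inr ⟨hz, Or.inl hadj1.reachable⟩)
        · exact Or.inl hadj1.reachable
        · exact Or.inr (Or.inr ⟨hz, Or.inl hadj1.reachable⟩)
    · have hadj2 : (openGraph (ends '' (↑s₂ : Set ι))).Adj b c := by
        rw [openGraph_image_adj]; exact ⟨⟨i, hi2, hi⟩, hne⟩
      have key : ∀ a : V, b ∈ openCluster (ends '' (↑s₁ : Set ι)) a → b = a ∨ b = x ∨ b = z := by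
        intro a hb
        by_cases hba : b = a
        · exact Or.inl hba
        · obtain ⟨e, he, hbe⟩ := exists_edge_of_mem_openCluster ends hb hba
          exact Or.inr (hsep e he i hi2 b hbe hbi)
      rcases ih with hb | hb | ⟨hz, hb | hb⟩
      · rcases key x hb with rfl | rfl | rfl
        · exact Or.inr (Or.inl hadj2.reachable)
        · exact Or.inr (Or.inl hadj2.reachable)
        · exact Or.inr (Or.inr ⟨Or.inl hb, Or.inr hadj2.reachable⟩)
      · exact Or.inr (Or.inl (SimpleGraph.Reachable.trans hb hadj2.reachable))
      · rcases key z hb with rfl | rfl | rfl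
        · exact Or.inr (Or.inr ⟨hz, Or.inr hadj2.reachable⟩)
        · exact Or.inr (Or.inl hadj2.reachable)
        · exact Or.inr (Or.inr ⟨hz, Or.inr hadj2.reachable⟩)
      · exact Or.inr (Or.inr ⟨hz, Or.inr (SimpleGraph.Reachable.trans hb hadj2.reachable)⟩)

/-- **Parallel gluing in the through case.**  If the edges of `s₁`, `s₂` can only share `x, z` and `z ∈ C_x(s₁) ∪ C_x(s₂)` (one piece is red-through), then
`C_x(s₁ ∪ s₂) = C_x(s₁) ∪ C_x(s₂) ∪ C_z(s₁) ∪ C_z(s₂)`. [cite: KozmaNitzan2024, §5.5 (context only; folklore)] -/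
theorem mem_openCluster_union_parallel_through [DecidableEq ι] (ends : ι → Sym2 V) {s₁ s₂ : Finset ι} {x z : V}
    (hsep : ∀ e ∈ s₁, ∀ e' ∈ s₂, ∀ w : V, w ∈ ends e → w ∈ ends e' → w = x ∨ w = z)
    (hz : z ∈ openCluster (ends '' (↑s₁ : Set ι)) x ∨ z ∈ openCluster (ends '' (↑s₂ : Set ι)) x) (y : V) :
    y ∈ openCluster (ends '' (↑(s₁ ∪ s₂) : Set ι)) x ↔
      y ∈ openCluster (ends '' (↑s₁ : Set ι)) x ∨ y ∈ openCluster (ends '' (↑s₂ : Set ι)) x ∨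
        y ∈ openCluster (ends '' (↑s₁ : Set ι)) z ∨ y ∈ openCluster (ends '' (↑s₂ : Set ι)) z := by
  have hz' : z ∈ openCluster (ends '' (↑(s₁ ∪ s₂) : Set ι)) x := by
    rcases hz with hz | hz
    · exact openCluster_image_mono ends Finset.subset_union_left x hz
    · exact openCluster_image_mono ends Finset.subset_union_right x hz
  constructor
  · intro hy
    rcases mem_openCluster_union_parallel_subset ends hsep hy with h | h | ⟨_, h | h⟩
    · exact Or.inl h
    · exact Or.inr (Or.inl h)
    · exact Or.inr (Or.inr (Or.inl h))
    · exact Or.inr (Or.inr (Or.inr h))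
  · rintro (hy | hy | hy | hy)
    · exact openCluster_image_mono ends Finset.subset_union_left x hy
    · exact openCluster_image_mono ends Finset.subset_union_right x hy
    · exact SimpleGraph.Reachable.trans hz' (openCluster_image_mono ends Finset.subset_union_left z hy)
    · exact SimpleGraph.Reachable.trans hz' (openCluster_image_mono ends Finset.subset_union_right z hy)

/-- **Parallel gluing, both cases.**  If the edges of `s₁`, `s₂` can only share `x, z`, then `y ∈ C_x(s₁ ∪ s₂)` iff `y ∈ C_x(s₁) ∪ C_x(s₂)`, or `z ∈ C_x(s₁) ∪ C_x(s₂)`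
and `y ∈ C_z(s₁) ∪ C_z(s₂)` — the formula `A^x = A′^x ∪ A″^x ∪ [ρ]({z} ∪ A′^z ∪ A″^z)` of the type calculus (memo CW-SP-gen69 §3).
[cite: KozmaNitzan2024, §5.5 (context only; folklore)] -/
theorem mem_openCluster_union_parallel_iff [DecidableEq ι] (ends : ι → Sym2 V) {s₁ s₂ : Finset ι} {x z : V}
    (hsep : ∀ e ∈ s₁, ∀ e' ∈ s₂, ∀ w : V, w ∈ ends e → w ∈ ends e' → w = x ∨ w = z) (y : V) :
    y ∈ openCluster (ends '' (↑(s₁ ∪ s₂) : Set ι)) x ↔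
      y ∈ openCluster (ends '' (↑s₁ : Set ι)) x ∨ y ∈ openCluster (ends '' (↑s₂ : Set ι)) x ∨
        ((z ∈ openCluster (ends '' (↑s₁ : Set ι)) x ∨ z ∈ openCluster (ends '' (↑s₂ : Set ι)) x) ∧
          (y ∈ openCluster (ends '' (↑s₁ : Set ι)) z ∨ y ∈ openCluster (ends '' (↑s₂ : Set ι)) z)) := by
  constructor
  · exact mem_openCluster_union_parallel_subset ends hsep
  · rintro (hy | hy | ⟨hz, hy⟩)
    · exact openCluster_image_mono ends Finset.subset_union_left x hy
    · exact openCluster_image_mono ends Finset.subset_union_right x hy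
    · rcases (mem_openCluster_union_parallel_through ends hsep hz y).mpr (Or.inr (Or.inr hy)) with h
      exact h

end Coefficientwise

end Summit.CriticalPhenomena.PercolationContinuityZ3.Theorems
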